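import Literature.NumberTheory.EllipticCurves.IwasawaTwistModPDual
import HarnessLib

/-!
# The pairing side of the translate (`stub_coreX9`, crux 19276 `MuTransferX9`): every coefficient of
# the `A_J`-valued Gorenstein pairing of the twists `𝒯_J(ρ, κ) × 𝒯_J(ρ′, κ⁻¹)` is `Γ_K`-equivariant,
# so Lemma 4's valuation `ν = v_T⟨x, x^*⟩_{A_J}` is constant on `Γ_K`-translates

Cell `b2b-bsdres` (X9 prover lineage, GEN 44) serving the K6 route `SmallImageMuTransfer` of cell
`bsd-smallim`. HONEST FRAMING: the cell deletes COMBINATION-SHAPED residual classes of the rank-≤1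
BSD formula from PUBLISHED theorems only and TYPES the construction-shaped remainder; this is not
"finishing BSD"; class X9 stays TYPED at class level. `--supports` helper toward `stub_coreX9` of
stmt-BirchSwinnertonDyer-19276; books nothing, closes nothing; theorems only (no definition, no
named fact).

Companion of `…X9StepTwoLocal.lean` (p448257): there, STEP 2 of MU-TRANSFER-PROOF §5 is delivered at
the DISTINGUISHED local Frobenius of `ℚ_v`, whose joint value is a `Γ_ℚ`-TRANSLATE `t•w` of the pair
`w = (x, x^*)` chosen by Lemma 4 (`v_T⟨x, x^*⟩_{A_e} ≤ 1`), not `w` itself ("Another `𝔔` conjugates the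
pair by some `g ∈ G` and multiplies `⟨·,·⟩` by `ω(g) ≠ 0`: `ν` depends on `q` only", memo §5 STEP 2).
Here is the one-line reason the translate is harmless, in k6-ty's `convCoeff` / `gorensteinPairing`
currency (file `IwasawaTwistModPDual`, whose `gorensteinPairing_twistModP_smul` is the TOP coefficient):

* §1 `shiftEnd_pow_twistModP_apply`: `S^m` commutes with the twisted action (`S` is `Γ_K`-linear).
* §2 **`convCoeff_twistModP_smul`**: for EVERY `k < J`,
  `C_k(g·x, g·y) = g·C_k(x, y)` (`g` acting on `𝒯_J(ρ, κ)`, `𝒯_J(ρ′, κ⁻¹)` and on the value module `P`,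
  e.g. `μ_p` through `ω`), from `C_k(x, y) = B(S^{J−1−k} x, y)` (`gorensteinPairing_shiftEnd_pow_left`) and
  the top-coefficient equivariance; hence `C_k(g·x, g·y) = 0 ↔ C_k(x, y) = 0`
  (`convCoeff_twistModP_smul_eq_zero_iff`) and the transport of the schema's Lemma-4 output
  "`C_0 ≠ 0 ∨ C_1 ≠ 0`" (`hpair0`/`hpair1` of `LevelE.theoremA_contradiction_schema`) along translates
  (`convCoeff_zero_ne_zero_or_one_ne_zero_iff_twistModP_smul`).
* §3 the `W.modPTwist` spelling for an elliptic curve (`𝒯_J(E, κ) × 𝒯_J(E, κ⁻¹)`, any equivariant `e`,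
  e.g. the Weil pairing into `μ_p`).

PARTITION (D-0054): X9 (A4) · X10∧¬Surj (A5) at `p = 3` (prime-generic statements) —
hypothesis-discharging helper toward `stub_coreX9`; closes NONE.

References: B. Howard, Compos. Math. 140 (2004) Prop. 3.2.4 [Howard2004HeegnerKolyvagin]; B. Mazur,
K. Rubin, Mem. AMS 799 (2004) §1.3, §5.3 [MazurRubin2004]; L. Washington, *Cyclotomic Fields*,
§13.1–§13.2 [Washington1997]; HOME/koly/MU-TRANSFER-PROOF.md (F7) "`⟨gx, gx^*⟩ = ω(g)⟨x, x^*⟩`" and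
§5 STEP 2.
-/

-- the summit and its single problem are both named `BirchSwinnertonDyer` (registry layout D-0017)
set_option linter.dupNamespace false

set_option autoImplicit false

noncomputable section

open Field WeierstrassCurve Literature.NumberTheory.EllipticCurves
  Literature.NumberTheory.GaloisRepresentations Function

universe u

namespace Summit.BirchSwinnertonDyer.BirchSwinnertonDyer.Rank1Residual.TranslatePairing

/-! ### §1 `S^m` commutes with the twisted action -/

section Shift

variable {K : Type u} [Field K] {p : ℕ} [Fact p.Prime] (κ : ZpExtension K p)
  {M : Type u} [AddCommGroup M] [TopologicalSpace M] [DiscreteTopology M]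
  (ρ : DiscreteGaloisModule K M) (hM : ∀ x : M, p • x = 0) (J : ℕ)

/-- `S^m (g·x) = g·(S^m x)` on `𝒯_J(ρ, κ)`: the twisted action is `𝔽_p[T]/(T^J)`-linear
(iterate of k6-ty's `shiftEnd_twistModP_apply`). [cite: Washington1997, §13.1–§13.2] -/
theorem shiftEnd_pow_twistModP_apply (m : ℕ) (g : absoluteGaloisGroup K) (x : Fin J → M) :
    (shiftEnd M J ^ m) (κ.twistModP ρ hM J g x) = κ.twistModP ρ hM J g ((shiftEnd M J ^ m) x) := by
  induction m generalizing x with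
  | zero => simp
  | succ m ih =>
    rw [pow_succ, Module.End.mul_apply, Module.End.mul_apply,
      ZpExtension.shiftEnd_twistModP_apply, ih]

end Shift

/-! ### §2 Every convolution coefficient is equivariant -/

section Equivariance

variable {K : Type u} [Field K] {p : ℕ} [Fact p.Prime] (κ : ZpExtension K p)
  {M M' P : Type u} [AddCommGroup M] [TopologicalSpace M] [DiscreteTopology M]
  [AddCommGroup M'] [TopologicalSpace M'] [DiscreteTopology M']
  [AddCommGroup P] [TopologicalSpace P] [DiscreteTopology P]
  (ρ : DiscreteGaloisModule K M) (ρ' : DiscreteGaloisModule K M') (ρP : DiscreteGaloisModule K P)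
  (hM : ∀ x : M, p • x = 0) (hM' : ∀ x : M', p • x = 0) (J : ℕ)
  {e : M →+ M' →+ P}
  (he : ∀ (g : absoluteGaloisGroup K) (m : M) (m' : M'), e (ρ g m) (ρ' g m') = ρP g (e m m'))

include he in
/-- **Every coefficient of the `A_J`-valued Gorenstein pairing is `Γ_K`-equivariant**:
`C_k(g·x, g·y) = g·C_k(x, y)` for `k < J`, `g` acting on `𝒯_J(ρ, κ)` by `(1+S)^{κ(g)} ∘ ρ(g)`, on
`𝒯_J(ρ′, κ⁻¹)` by `(1+S)^{−κ(g)} ∘ ρ′(g)`, on `P` by `ρP` — MU-TRANSFER-PROOF (F7)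
"`⟨gx, gx^*⟩ = ω(g)⟨x, x^*⟩`", coefficientwise.  From `C_k(x, y) = B(S^{J−1−k} x, y)` and the
equivariance of the top coefficient `B` (k6-ty `gorensteinPairing_twistModP_smul`).
[cite: Howard2004HeegnerKolyvagin, Prop. 3.2.4] [cite: MazurRubin2004, §1.3 and §5.3] -/
theorem convCoeff_twistModP_smul {k : ℕ} (hk : k < J) (g : absoluteGaloisGroup K) (x : Fin J → M)
    (y : Fin J → M') :
    convCoeff e J k (κ.twistModP ρ hM J g x) (κ.invTwist.twistModP ρ' hM' J g y) =
      ρP g (convCoeff e J k x y) := by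
  have hm : J - 1 - k < J := by omega
  have hk' : J - 1 - (J - 1 - k) = k := by omega
  rw [← hk', ← gorensteinPairing_shiftEnd_pow_left e hm, ← gorensteinPairing_shiftEnd_pow_left e hm,
    shiftEnd_pow_twistModP_apply, κ.gorensteinPairing_twistModP_smul ρ ρ' ρP hM hM' J he]

include he in
/-- **Vanishing of a coefficient is translation-invariant**: `C_k(g·x, g·y) = 0 ↔ C_k(x, y) = 0`
(`k < J`). [cite: Howard2004HeegnerKolyvagin, Prop. 3.2.4] [cite: MazurRubin2004, §1.3 and §5.3] -/
theorem convCoeff_twistModP_smul_eq_zero_iff {k : ℕ} (hk : k < J) (g : absoluteGaloisGroup K)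
    (x : Fin J → M) (y : Fin J → M') :
    convCoeff e J k (κ.twistModP ρ hM J g x) (κ.invTwist.twistModP ρ' hM' J g y) = 0 ↔
      convCoeff e J k x y = 0 := by
  rw [convCoeff_twistModP_smul κ ρ ρ' ρP hM hM' J he hk]
  constructor
  · intro h
    have h' := congrArg (ρP g⁻¹) h
    rwa [map_zero, ← Module.End.mul_apply, ← map_mul, inv_mul_cancel, map_one,
      Module.End.one_apply] at h'
  · intro h
    rw [h, map_zero]

include he in
/-- **Lemma 4's output survives the translate** (the disjunction `hpair0`/`hpair1` of
`LevelE.theoremA_contradiction_schema` read through `exists_mem_pairingCoeff_ne_zero`: "the constant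
or the `T¹`-coefficient of `⟨x, x^*⟩_{A_J}` is non-zero", `J ≥ 2`): it holds for `(g·x, g·x^*)` iff it
holds for `(x, x^*)` — "`ν` depends on `q` only" (memo §5 STEP 2).
[cite: Howard2004HeegnerKolyvagin, Prop. 3.2.4] [cite: MazurRubin2004, §1.3 and §5.3] -/
theorem convCoeff_zero_ne_zero_or_one_ne_zero_iff_twistModP_smul (hJ : 2 ≤ J)
    (g : absoluteGaloisGroup K) (x : Fin J → M) (y : Fin J → M') :
    (convCoeff e J 0 (κ.twistModP ρ hM J g x) (κ.invTwist.twistModP ρ' hM' J g y) ≠ 0 ∨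
        convCoeff e J 1 (κ.twistModP ρ hM J g x) (κ.invTwist.twistModP ρ' hM' J g y) ≠ 0) ↔
      (convCoeff e J 0 x y ≠ 0 ∨ convCoeff e J 1 x y ≠ 0) := by
  rw [Ne, Ne, convCoeff_twistModP_smul_eq_zero_iff κ ρ ρ' ρP hM hM' J he (by omega),
    convCoeff_twistModP_smul_eq_zero_iff κ ρ ρ' ρP hM hM' J he (by omega)]

include he in
/-- All coefficients of index `< J` at once: the coefficient vector of the translate is `g` applied to
the coefficient vector (the `A_J ⊗ P`-valued pairing is `Γ_K`-equivariant).
[cite: Howard2004HeegnerKolyvagin, Prop. 3.2.4] [cite: MazurRubin2004, §1.3 and §5.3] -/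
theorem forall_convCoeff_twistModP_smul (g : absoluteGaloisGroup K) (x : Fin J → M) (y : Fin J → M') :
    ∀ k < J, convCoeff e J k (κ.twistModP ρ hM J g x) (κ.invTwist.twistModP ρ' hM' J g y) =
      ρP g (convCoeff e J k x y) :=
  fun _ hk => convCoeff_twistModP_smul κ ρ ρ' ρP hM hM' J he hk g x y

end Equivariance

/-! ### §3 The elliptic-curve spelling `𝒯_J(E, κ) × 𝒯_J(E, κ⁻¹)` -/

section Elliptic

variable {F : Type u} [Field F] (W : WeierstrassCurve F) (p : ℕ) [Fact p.Prime]
  (κ : ZpExtension F p) (J : ℕ)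
  {P : Type u} [AddCommGroup P] [TopologicalSpace P] [DiscreteTopology P]
  (ρP : DiscreteGaloisModule F P)
  {e : geomTorsion W (p : ℤ) →+ geomTorsion W (p : ℤ) →+ P}
  (he : ∀ (g : absoluteGaloisGroup F) (m m' : geomTorsion W (p : ℤ)),
    e (g • m) (g • m') = ρP g (e m m'))

include he in
/-- **For an elliptic curve**: with `e : E[p] × E[p] → P` any `Γ_F`-equivariant pairing
(`e(g·m, g·m′) = g·e(m, m′)`; e.g. the Weil pairing into `μ_p`, `g` acting on `μ_p` by `ω(g)`), every
coefficient of the Gorenstein pairing `𝒯_J(E, κ) × 𝒯_J(E, κ⁻¹) → P` (`W.modPTwist p κ J`,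
`W.modPTwist p κ.invTwist J`) is equivariant: `C_k(g·x, g·x^*) = g·C_k(x, x^*)`, `k < J`.
[cite: Howard2004HeegnerKolyvagin, Prop. 3.2.4] [cite: MazurRubin2004, §1.3 and §5.3] -/
theorem convCoeff_modPTwist_smul {k : ℕ} (hk : k < J) (g : absoluteGaloisGroup F)
    (x y : Fin J → geomTorsion W (p : ℤ)) :
    convCoeff e J k (W.modPTwist p κ J g x) (W.modPTwist p κ.invTwist J g y) =
      ρP g (convCoeff e J k x y) :=
  convCoeff_twistModP_smul κ (W.torsionGaloisModule (p : ℤ)) (W.torsionGaloisModule (p : ℤ)) ρP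
    (fun Q => AddSubgroup.torsionBy.nsmul Q) (fun Q => AddSubgroup.torsionBy.nsmul Q) J
    (fun g m m' => by rw [torsionGaloisModule_apply_apply, torsionGaloisModule_apply_apply, he]) hk g x y

include he in
/-- **For an elliptic curve: Lemma 4's output survives the translate** (`J ≥ 2`): the disjunction
"`C_0(x, x^*) ≠ 0 ∨ C_1(x, x^*) ≠ 0`" holds at `(g·x, g·x^*)` iff at `(x, x^*)`.
[cite: Howard2004HeegnerKolyvagin, Prop. 3.2.4] [cite: MazurRubin2004, §1.3 and §5.3] -/
theorem convCoeff_zero_ne_zero_or_one_ne_zero_iff_modPTwist_smul (hJ : 2 ≤ J)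
    (g : absoluteGaloisGroup F) (x y : Fin J → geomTorsion W (p : ℤ)) :
    (convCoeff e J 0 (W.modPTwist p κ J g x) (W.modPTwist p κ.invTwist J g y) ≠ 0 ∨
        convCoeff e J 1 (W.modPTwist p κ J g x) (W.modPTwist p κ.invTwist J g y) ≠ 0) ↔
      (convCoeff e J 0 x y ≠ 0 ∨ convCoeff e J 1 x y ≠ 0) :=
  convCoeff_zero_ne_zero_or_one_ne_zero_iff_twistModP_smul κ (W.torsionGaloisModule (p : ℤ))
    (W.torsionGaloisModule (p : ℤ)) ρP (fun Q => AddSubgroup.torsionBy.nsmul Q)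
    (fun Q => AddSubgroup.torsionBy.nsmul Q) J
    (fun g m m' => by rw [torsionGaloisModule_apply_apply, torsionGaloisModule_apply_apply, he]) hJ g x y

end Elliptic

end Summit.BirchSwinnertonDyer.BirchSwinnertonDyer.Rank1Residual.TranslatePairing

end
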